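import Summits.HubbardSuperconductivity.HubbardSuperconductivity.Theorems.KkFloorKkFloorTheorem

/-!
# Line `KkSubspaceFloor` — the next rung over the proved floor `KkFloorTheorem` (route `KkFloor`)
# filed on crux `KkBandLift` (stmt-HubbardSuperconductivity-10402): the AMPLITUDE re-flooring

Forward-generator (G1 next-rung) workfile, planner `planner-fwd-rung-HubbardSuperconductivity-01-0`,
2026-08-17. `sorry` only inside `stub_*`; the compositions `kkAmplitudeFloor_of` and
`KkSubspaceFloor_of` are kernel-checked.

## Floor → rung (one hypothesis generalised)

FLOOR (`Theorems.kkFloorTheorem_proof : Theses.KkFloor.KkFloorTheorem`, proved): for Hermitian `A`,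
`B ⪰ 0`, a subspace `V` invariant under `A` AND `B`, a ground state `ψ ∈ V` of `A|_V` at energy `E`,
and a profile `d` with `E + d(y) ≤ Re λ` for EVERY `V`-eigenpair of `A + iyB`, `y ∈ S`:
`∫_S d(y) y⁻² dy ≤ π ⟨ψ,Bψ⟩`.

RUNG (`KkSubspaceFloor`): the same conclusion when the spectral inclusion is only known for the
eigenpairs of `A + iyB` inside SOME `(A + iyB)`-invariant subspace `W_y ∋ ψ` (one for each `y`;
`W_y` need not be invariant under `A` or `B` separately). Graded family: selectors `𝒲` of such
subspaces ordered by inclusion (`KkFloorOn 𝒲`); the floor is the top member `sectorSel` (`W ≡ V`,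
witness `Lines/KkSubspaceFloor_special.lean`), the bottom member is the cyclic subspace of `ψ`
(`krylovSel`) — only the pencil modes the ground state itself excites have to lift.

WHERE THE FLOOR'S PROOF STOPS: `kkFloor_core` builds `u = log ρ(exp(-(A + zB))) + E` and needs
Vesentini (`isSubharmonicOn_log_spectralRadius_exp_pencil A B`, seed file lines 101–103, 178–189)
for the pencil RESTRICTED to the subspace — an analytic family only because `V` is `A`- and
`B`-invariant (the `Fin k` reduction, seed lines 262–340). For a merely `(A + iy₀B)`-invariant `W`
there is no restricted pencil at `z ≠ iy₀`. REPLACEMENT (the new idea): the ground state's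
monitored return amplitude `f_t(z) = ⟨ψ, e^{-t(A + zB - E)} ψ⟩` (`ampl`), an ENTIRE scalar function:
`log ‖f_t‖` is subharmonic (Ransford Thm 2.7? no — Lemma "log|holomorphic| is subharmonic",
tree `isSubharmonicOn_log_enorm`), `≤ 0` on `Re z ≥ 0` (contractivity of the dissipative
semigroup on `V`, `stub_contractivity`), `≥ -t x ⟨ψ,Bψ⟩` on the positive axis (Jensen for the
spectral measure of the Hermitian `A + xB` in `ψ`, `stub_jensen`), so the tree's half-plane lemma
`lintegral_boundary_le_of_subharmonic` applies verbatim and gives the ENGINE `KkAmplitudeFloor`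
(finite `t`, no spectral hypothesis at all: `∫ (-log‖f_t(iy)‖) y⁻² dy ≤ π t ⟨ψ,Bψ⟩`). The rung
follows because the decay rate of `f_t(iy)` dominates the abscissa lift of `A + iyB` on any
invariant `W ∋ ψ` as `t → ∞` (Gelfand's formula for `exp(-(T|_W - E))`, `stub_liminf_rate`) and
Fatou's lemma in `t`.

## Why this is the S-ward rung (gap_after in `Lines/KkSubspaceFloor.md`)

The crux-strategist census (`Cruxes/KkBandLift/STRATEGY-CENSUS.md`, `StrategistNegation.lean`)
refutes every GLOBAL sector-abscissa lift on an `L`-uniform band (10402/10403/10404) by the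
finite-height floor + Rayleigh–Ritz over ARBITRARY sector states + the Koma–Tasaki thermal shell.
The amplitude engine has no Rayleigh–Ritz step: its interior values are controlled by `ψ` alone
(Jensen), so a band/window decay of the ground state's OWN monitored return amplitude — the
repaired target — is not excluded by thermal or phase-twisted states (their weight in `ψ` is what
enters, not their existence).

Sources: T. Ransford, *Potential Theory in the Complex Plane* (1995) §2.2–2.4, Thm 2.4.x
[doi:10.1017/cbo9780511623776]; the tree's `Literature.Analysis.Potential.HalfPlanePoissonBoundary`,
`Literature.Analysis.Pluripotential.VesentiniProofs`; Julia–Carathéodory / boundary Schwarz lemma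
for the half-plane (Garnett, *Bounded Analytic Functions*, Ch. I) for the shape
"angular derivative at a boundary maximum ≥ Poisson integral of the boundary deficit".
-/

set_option linter.dupNamespace false
set_option linter.unusedVariables false
set_option linter.unusedSectionVars false

noncomputable section

namespace Summit.HubbardSuperconductivity.HubbardSuperconductivity.Cruxes.KkBandLift.SubspaceFloor

open Matrix Complex MeasureTheory Set Filter
open scoped ENNReal ComplexOrder Topology Matrix.Norms.L2Operator
open Literature.Analysis.Pluripotential
open Summit.HubbardSuperconductivity.HubbardSuperconductivity.Theorems
  (setLIntegral_le_lintegral_of_forall_mem)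

/-! ### Objects -/

/-- The monitored return amplitude of `ψ` under the pencil: `⟨ψ, exp(-t (A + zB - E)) ψ⟩`.
[new] -/
def ampl {n : Type*} [Fintype n] [DecidableEq n] (A B : Matrix n n ℂ) (E t : ℝ) (ψ : n → ℂ)
    (z : ℂ) : ℂ :=
  star ψ ⬝ᵥ (NormedSpace.exp (-((t : ℂ) • (A + z • B - (E : ℂ) • (1 : Matrix n n ℂ))))) *ᵥ ψ

/-- A SELECTOR of subspaces: to the data `(A, B, V, ψ)` and a height `y` it assigns the subspace on
which the spectral inclusion is required. -/
abbrev WSel : Type 1 :=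
  ∀ (n : Type) [Fintype n] [DecidableEq n],
    Matrix n n ℂ → Matrix n n ℂ → Submodule ℂ (n → ℂ) → (n → ℂ) → ℝ → Submodule ℂ (n → ℂ)

/-- The floor's selector: the whole invariant subspace `V` (top of the family). -/
def sectorSel : WSel := fun _n _ _ _A _B V _ψ _y => V

/-- The minimal selector: the cyclic subspace of `ψ` under `A + iyB` (bottom of the family). -/
def krylovSel : WSel := fun n _ _ A B _V ψ y =>
  Submodule.span ℂ (Set.range fun k : ℕ => ((A + (Complex.I * (y : ℂ)) • B) ^ k) *ᵥ ψ)

/-- **Member `𝒲` of the graded family**: the Kramers–Kronig floor with the spectral inclusion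
required only for eigenpairs of `A + iyB` in the `(A + iyB)`-invariant subspace `𝒲 n A B V ψ y ∋ ψ`.
[new] -/
def KkFloorOn (𝒲 : WSel) : Prop :=
  ∀ (n : Type) [Fintype n] [DecidableEq n] (A B : Matrix n n ℂ) (V : Submodule ℂ (n → ℂ)) (E : ℝ)
    (S : Set ℝ) (d : ℝ → ℝ) (ψ : n → ℂ), A.IsHermitian → B.IsHermitian →
    (∀ v : n → ℂ, 0 ≤ (star v ⬝ᵥ B *ᵥ v).re) → (∀ v ∈ V, A *ᵥ v ∈ V) → (∀ v ∈ V, B *ᵥ v ∈ V) →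
    (∀ v ∈ V, star v ⬝ᵥ v = 1 → E ≤ (star v ⬝ᵥ A *ᵥ v).re) → ψ ∈ V → star ψ ⬝ᵥ ψ = 1 →
    A *ᵥ ψ = (E : ℂ) • ψ →
    (∀ y ∈ S, ψ ∈ 𝒲 n A B V ψ y) →
    (∀ y ∈ S, ∀ v ∈ 𝒲 n A B V ψ y, (A + (Complex.I * (y : ℂ)) • B) *ᵥ v ∈ 𝒲 n A B V ψ y) →
    (∀ y ∈ S, ∀ v ∈ 𝒲 n A B V ψ y, v ≠ 0 → ∀ lam : ℂ,
      (A + (Complex.I * (y : ℂ)) • B) *ᵥ v = lam • v → E + d y ≤ lam.re) →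
    ∫⁻ y in S, ENNReal.ofReal (d y / y ^ 2) ≤ ENNReal.ofReal (Real.pi * (star ψ ⬝ᵥ B *ᵥ ψ).re)

/-- **The rung `KkSubspaceFloor`**: the floor holds for EVERY selector. [new] -/
def KkSubspaceFloor : Prop := ∀ 𝒲 : WSel, KkFloorOn 𝒲

/-- **The engine `KkAmplitudeFloor`** (finite monitoring time `t > 0`, no spectral hypothesis):
`(∀ y ∈ S, ‖⟨ψ, e^{-t(A + iyB - E)} ψ⟩‖ ≤ e^{-t d(y)}) → ∫_S d(y) y⁻² dy ≤ π ⟨ψ,Bψ⟩`. [new] -/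
def KkAmplitudeFloor : Prop :=
  ∀ (n : Type) [Fintype n] [DecidableEq n] (A B : Matrix n n ℂ) (V : Submodule ℂ (n → ℂ)) (E t : ℝ)
    (S : Set ℝ) (d : ℝ → ℝ) (ψ : n → ℂ), A.IsHermitian → B.IsHermitian →
    (∀ v : n → ℂ, 0 ≤ (star v ⬝ᵥ B *ᵥ v).re) → (∀ v ∈ V, A *ᵥ v ∈ V) → (∀ v ∈ V, B *ᵥ v ∈ V) →
    (∀ v ∈ V, star v ⬝ᵥ v = 1 → E ≤ (star v ⬝ᵥ A *ᵥ v).re) → ψ ∈ V → star ψ ⬝ᵥ ψ = 1 →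
    A *ᵥ ψ = (E : ℂ) • ψ → 0 < t →
    (∀ y ∈ S, ‖ampl A B E t ψ (Complex.I * (y : ℂ))‖ ≤ Real.exp (-(t * d y))) →
    ∫⁻ y in S, ENNReal.ofReal (d y / y ^ 2) ≤ ENNReal.ofReal (Real.pi * (star ψ ⬝ᵥ B *ᵥ ψ).re)

/-! ### The three stubs (each a genuine matrix-analysis lemma; sizes M, M, M/L) -/

/-- **s1 `Contractivity`**: on the closed right half-plane the monitored return amplitude has
modulus `≤ 1`: `Re⟨v,(A + zB - E)v⟩ ≥ 0` on `V` (Rayleigh bound + `B ⪰ 0`, `Re z ≥ 0`), so the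
semigroup `e^{-t(A + zB - E)}` contracts on the invariant subspace `V ∋ ψ` (Lumer–Phillips in
finite dimension). [folklore] -/
def Contractivity : Prop :=
  ∀ (n : Type) [Fintype n] [DecidableEq n] (A B : Matrix n n ℂ) (V : Submodule ℂ (n → ℂ)) (E t : ℝ)
    (ψ : n → ℂ), A.IsHermitian → B.IsHermitian → (∀ v : n → ℂ, 0 ≤ (star v ⬝ᵥ B *ᵥ v).re) →
    (∀ v ∈ V, A *ᵥ v ∈ V) → (∀ v ∈ V, B *ᵥ v ∈ V) →
    (∀ v ∈ V, star v ⬝ᵥ v = 1 → E ≤ (star v ⬝ᵥ A *ᵥ v).re) → ψ ∈ V → star ψ ⬝ᵥ ψ = 1 → 0 ≤ t →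
    ∀ z : ℂ, 0 ≤ z.re → ‖ampl A B E t ψ z‖ ≤ 1

/-- stub s1 (M). -/
theorem stub_contractivity : Contractivity := by
  sorry

/-- **s2 `JensenBound`**: on the real axis the amplitude is real and
`⟨ψ, e^{-t(A + xB - E)} ψ⟩ ≥ e^{-t x ⟨ψ,Bψ⟩}` — Jensen's inequality for the spectral measure of the
Hermitian matrix `A + xB - E` in the unit vector `ψ`, whose mean is `x⟨ψ,Bψ⟩` because
`(A - E)ψ = 0`. [folklore] -/
def JensenBound : Prop :=
  ∀ (n : Type) [Fintype n] [DecidableEq n] (A B : Matrix n n ℂ) (E t : ℝ) (ψ : n → ℂ),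
    A.IsHermitian → B.IsHermitian → star ψ ⬝ᵥ ψ = 1 → A *ᵥ ψ = (E : ℂ) • ψ → 0 ≤ t →
    ∀ x : ℝ, Real.exp (-(t * x * (star ψ ⬝ᵥ B *ᵥ ψ).re)) ≤ ‖ampl A B E t ψ (x : ℂ)‖

/-- stub s2 (M). -/
theorem stub_jensen : JensenBound := by
  sorry

/-- **s4 `LiminfRate`**: if `W ∋ ψ` is invariant under `T = A + iyB` and every eigenpair of `T` in
`W` has `Re λ ≥ E + δ`, then the decay rate of the amplitude dominates `δ`:
`δ ≤ liminf_k (-log ‖⟨ψ, e^{-(k+1)(T - E)} ψ⟩‖) / (k+1)` (Gelfand's spectral radius formula for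
`exp(-(T|_W - E))`, whose spectral radius is `e^{-(min Re σ(T|_W) - E)} ≤ e^{-δ}` by spectral mapping;
value `+∞` where the amplitude vanishes). [folklore] -/
def LiminfRate : Prop :=
  ∀ (n : Type) [Fintype n] [DecidableEq n] (A B : Matrix n n ℂ) (E : ℝ) (ψ : n → ℂ) (y δ : ℝ)
    (W : Submodule ℂ (n → ℂ)), ψ ∈ W →
    (∀ v ∈ W, (A + (Complex.I * (y : ℂ)) • B) *ᵥ v ∈ W) →
    (∀ v ∈ W, v ≠ 0 → ∀ lam : ℂ,
      (A + (Complex.I * (y : ℂ)) • B) *ᵥ v = lam • v → E + δ ≤ lam.re) →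
    ENNReal.ofReal δ ≤ Filter.liminf (fun k : ℕ =>
      (-(ENNReal.log ‖ampl A B E ((k : ℝ) + 1) ψ (Complex.I * (y : ℂ))‖ₑ)).toENNReal *
        ENNReal.ofReal (1 / ((k : ℝ) + 1))) Filter.atTop

/-- stub s4 (M/L). -/
theorem stub_liminf_rate : LiminfRate := by
  sorry

/-! ### Proved: analyticity of the amplitude -/

section Analytic

variable {n : Type*} [Fintype n] [DecidableEq n]

/-- The pairing `X ↦ ⟨ψ, X ψ⟩` as a linear functional on matrices. -/
def pairing (ψ : n → ℂ) : Matrix n n ℂ →ₗ[ℂ] ℂ where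
  toFun X := star ψ ⬝ᵥ X *ᵥ ψ
  map_add' X Y := by simp only [add_mulVec, dotProduct_add]
  map_smul' c X := by simp only [smul_mulVec, dotProduct_smul, smul_eq_mul, RingHom.id_apply]

/-- The amplitude is an entire function of the coupling `z`. [folklore] -/
theorem ampl_differentiable (A B : Matrix n n ℂ) (E t : ℝ) (ψ : n → ℂ) :
    Differentiable ℂ (ampl A B E t ψ) := by
  have hM : Differentiable ℂ
      (fun z : ℂ => -((t : ℂ) • (A + z • B - (E : ℂ) • (1 : Matrix n n ℂ)))) := by
    refine Differentiable.neg (Differentiable.const_smul ?_ (t : ℂ))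
    exact ((differentiable_const A).add (differentiable_id.smul_const B)).sub
      (differentiable_const _)
  have hexp : Differentiable ℂ
      (fun z : ℂ => NormedSpace.exp (-((t : ℂ) • (A + z • B - (E : ℂ) • (1 : Matrix n n ℂ))))) :=
    fun z => (NormedSpace.exp_analytic (𝕂 := ℂ) _).differentiableAt.comp z (hM z)
  have hL : Differentiable ℂ (fun X : Matrix n n ℂ => (pairing ψ) X) := by
    have := (LinearMap.toContinuousLinearMap (pairing ψ)).differentiable
    simpa using this
  exact hL.comp hexp

/-- Measurability of the boundary trace `y ↦ log ‖f_t(iy)‖ₑ` (it is continuous). [folklore] -/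
theorem measurable_log_ampl (A B : Matrix n n ℂ) (E t : ℝ) (ψ : n → ℂ) :
    Measurable fun y : ℝ => ENNReal.log ‖ampl A B E t ψ (Complex.I * (y : ℂ))‖ₑ := by
  refine (ENNReal.continuous_log.comp (continuous_enorm.comp ?_)).measurable
  exact (ampl_differentiable A B E t ψ).continuous.comp (continuous_const.mul continuous_ofReal)

end Analytic

/-! ### Proved: the engine `KkAmplitudeFloor` from s1 + s2 (the tree's half-plane lemma) -/

/-- **Core inequality** (no hypothesis on the boundary trace): for `t > 0`,
`∫ (-log ‖f_t(iy)‖) y⁻² dy ≤ π t ⟨ψ,Bψ⟩`. [new] -/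
theorem amplitude_core (h1 : Contractivity) (h2 : JensenBound)
    (n : Type) [Fintype n] [DecidableEq n] (A B : Matrix n n ℂ) (V : Submodule ℂ (n → ℂ)) (E t : ℝ)
    (ψ : n → ℂ) (hA : A.IsHermitian) (hB : B.IsHermitian)
    (hBpos : ∀ v : n → ℂ, 0 ≤ (star v ⬝ᵥ B *ᵥ v).re) (hAV : ∀ v ∈ V, A *ᵥ v ∈ V)
    (hBV : ∀ v ∈ V, B *ᵥ v ∈ V) (hE : ∀ v ∈ V, star v ⬝ᵥ v = 1 → E ≤ (star v ⬝ᵥ A *ᵥ v).re)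
    (hψV : ψ ∈ V) (hψ1 : star ψ ⬝ᵥ ψ = 1) (hAψ : A *ᵥ ψ = (E : ℂ) • ψ) (ht : 0 < t) :
    ∫⁻ y : ℝ, (-(ENNReal.log ‖ampl A B E t ψ (Complex.I * (y : ℂ))‖ₑ)).toENNReal *
        ENNReal.ofReal (1 / y ^ 2) ≤
      ENNReal.ofReal (Real.pi * (t * (star ψ ⬝ᵥ B *ᵥ ψ).re)) := by
  set u : ℂ → EReal := fun z => ENNReal.log ‖ampl A B E t ψ z‖ₑ with hu_def
  set β : ℝ := (star ψ ⬝ᵥ B *ᵥ ψ).re with hβ_def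
  -- (u0) `u ≤ 0` on the closed right half-plane: contractivity
  have hu0 : ∀ z : ℂ, 0 ≤ z.re → u z ≤ 0 := by
    intro z hz
    have h := h1 n A B V E t ψ hA hB hBpos hAV hBV hE hψV hψ1 ht.le z hz
    have hle : ‖ampl A B E t ψ z‖ₑ ≤ 1 := by
      rw [← ofReal_norm]
      exact ENNReal.ofReal_le_one.2 h
    simp only [hu_def]
    calc ENNReal.log ‖ampl A B E t ψ z‖ₑ ≤ ENNReal.log 1 := ENNReal.log_monotone hle
      _ = 0 := ENNReal.log_one
  -- (ux) `u(x) ≥ -x (tβ)` on the positive axis: Jensen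
  have hux : ∀ x : ℝ, 0 < x → ((-(x * (t * β)) : ℝ) : EReal) ≤ u x := by
    intro x hx
    have h := h2 n A B E t ψ hA hB hψ1 hAψ ht.le x
    have hpos : 0 < Real.exp (-(t * x * β)) := Real.exp_pos _
    simp only [hu_def]
    calc ((-(x * (t * β)) : ℝ) : EReal)
        = ENNReal.log (ENNReal.ofReal (Real.exp (-(t * x * β)))) := by
          rw [ENNReal.log_ofReal_of_pos hpos, Real.log_exp]
          congr 1; ring
      _ ≤ ENNReal.log ‖ampl A B E t ψ (x : ℂ)‖ₑ := by
          refine ENNReal.log_monotone ?_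
          rw [← ofReal_norm]
          exact ENNReal.ofReal_le_ofReal h
  -- (usub) subharmonicity of the Cayley pull-backs: `log ‖holomorphic‖`
  have husub : ∀ x : ℝ, 0 < x →
      IsSubharmonicOn (fun ζ => u ((x : ℂ) * ((1 + ζ) / (1 - ζ)))) {ζ | ζ ≠ 1} := by
    intro x hx
    have hg : DifferentiableOn ℂ (fun ζ : ℂ => (x : ℂ) * ((1 + ζ) / (1 - ζ))) {ζ | ζ ≠ 1} := by
      intro ζ hζ
      refine (DifferentiableAt.const_mul ?_ _).differentiableWithinAt
      refine ((differentiableAt_const _).add differentiableAt_id).div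
        ((differentiableAt_const _).sub differentiableAt_id) ?_
      exact sub_ne_zero.mpr (Ne.symm hζ)
    have hf : DifferentiableOn ℂ (fun ζ : ℂ => ampl A B E t ψ ((x : ℂ) * ((1 + ζ) / (1 - ζ))))
        {ζ | ζ ≠ 1} :=
      (ampl_differentiable A B E t ψ).comp_differentiableOn hg
    exact isSubharmonicOn_log_enorm isOpen_ne hf
  -- (umeas) measurability of the boundary trace
  have humeas : Measurable fun y : ℝ => u (Complex.I * y) := measurable_log_ampl A B E t ψ
  -- the half-plane lemma
  exact Literature.Analysis.Potential.lintegral_boundary_le_of_subharmonic u (t * β) hu0 hux husub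
    humeas

/-- **The engine from the stubs**: `Contractivity → JensenBound → KkAmplitudeFloor`. -/
theorem kkAmplitudeFloor_of (h1 : Contractivity) (h2 : JensenBound) : KkAmplitudeFloor := by
  intro n _ _ A B V E t S d ψ hA hB hBpos hAV hBV hE hψV hψ1 hAψ ht hdec
  have hmain := amplitude_core h1 h2 n A B V E t ψ hA hB hBpos hAV hBV hE hψV hψ1 hAψ ht
  set u : ℝ → EReal := fun y => ENNReal.log ‖ampl A B E t ψ (Complex.I * (y : ℂ))‖ₑ with hu_def
  -- `t d(y) ≤ -u(iy)` on `S`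
  have hdom : ∀ y ∈ S, ENNReal.ofReal (t * (d y / y ^ 2)) ≤
      (-u y).toENNReal * ENNReal.ofReal (1 / y ^ 2) := by
    intro y hy
    have hneg : ((t * d y : ℝ) : EReal) ≤ -u y := by
      have hle : u y ≤ (((-(t * d y)) : ℝ) : EReal) := by
        simp only [hu_def]
        have hpos : 0 < Real.exp (-(t * d y)) := Real.exp_pos _
        calc ENNReal.log ‖ampl A B E t ψ (Complex.I * (y : ℂ))‖ₑ
            ≤ ENNReal.log (ENNReal.ofReal (Real.exp (-(t * d y)))) := by
              refine ENNReal.log_monotone ?_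
              rw [← ofReal_norm]
              exact ENNReal.ofReal_le_ofReal (hdec y hy)
          _ = (((-(t * d y)) : ℝ) : EReal) := by
              rw [ENNReal.log_ofReal_of_pos hpos, Real.log_exp]
      have := EReal.neg_le_neg_iff.mpr hle
      rwa [EReal.coe_neg, neg_neg] at this
    have hto : ENNReal.ofReal (t * d y) ≤ (-u y).toENNReal :=
      (EReal.real_coe_toENNReal (t * d y)).symm.le.trans (EReal.toENNReal_le_toENNReal hneg)
    by_cases hy0 : y = 0
    · simp [hy0]
    rcases le_or_gt (t * d y) 0 with hdy | hdy
    · have : t * (d y / y ^ 2) ≤ 0 := by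
        rw [mul_div_assoc']
        exact div_nonpos_of_nonpos_of_nonneg hdy (sq_nonneg y)
      rw [ENNReal.ofReal_of_nonpos this]
      exact bot_le
    · rw [mul_div_assoc', div_eq_mul_one_div, ENNReal.ofReal_mul hdy.le]
      exact mul_le_mul' hto le_rfl
  have hmeasG : Measurable fun y : ℝ => (-u y).toENNReal * ENNReal.ofReal (1 / y ^ 2) := by
    refine (measurable_log_ampl A B E t ψ).neg.ereal_toENNReal.mul
      (ENNReal.measurable_ofReal.comp ?_)
    exact (measurable_const (a := (1 : ℝ))).div (measurable_id.pow_const 2)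
  -- integrate and cancel `t`
  have hchain : ∫⁻ y in S, ENNReal.ofReal (t * (d y / y ^ 2)) ≤
      ENNReal.ofReal (Real.pi * (t * (star ψ ⬝ᵥ B *ᵥ ψ).re)) :=
    (setLIntegral_le_lintegral_of_forall_mem S hmeasG hdom).trans hmain
  have hlhs : ∫⁻ y in S, ENNReal.ofReal (t * (d y / y ^ 2)) =
      ENNReal.ofReal t * ∫⁻ y in S, ENNReal.ofReal (d y / y ^ 2) := by
    rw [← lintegral_const_mul' _ _ ENNReal.ofReal_ne_top]
    refine lintegral_congr fun y => ?_
    rw [ENNReal.ofReal_mul ht.le]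
  have hrhs : ENNReal.ofReal (Real.pi * (t * (star ψ ⬝ᵥ B *ᵥ ψ).re)) =
      ENNReal.ofReal t * ENNReal.ofReal (Real.pi * (star ψ ⬝ᵥ B *ᵥ ψ).re) := by
    rw [← ENNReal.ofReal_mul ht.le]
    congr 1; ring
  rw [hlhs, hrhs] at hchain
  exact (ENNReal.mul_le_mul_iff_right ((ENNReal.ofReal_pos.2 ht).ne') ENNReal.ofReal_ne_top).1 hchain

/-! ### Proved: the rung from the engine + s4 (Fatou in the monitoring time) -/

/-- **The rung from the stubs**: `Contractivity → JensenBound → LiminfRate → KkSubspaceFloor`. -/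
theorem KkSubspaceFloor_of (h1 : Contractivity) (h2 : JensenBound) (h4 : LiminfRate) :
    KkSubspaceFloor := by
  intro 𝒲 n _ _ A B V E S d ψ hA hB hBpos hAV hBV hE hψV hψ1 hAψ hψW hWinv hd
  set β : ℝ := (star ψ ⬝ᵥ B *ᵥ ψ).re with hβ_def
  -- the rescaled boundary traces at integer times `t = k + 1`
  set F : ℕ → ℝ → ℝ≥0∞ := fun k y =>
    (-(ENNReal.log ‖ampl A B E ((k : ℝ) + 1) ψ (Complex.I * (y : ℂ))‖ₑ)).toENNReal *
      ENNReal.ofReal (1 / ((k : ℝ) + 1)) with hF_def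
  set G : ℕ → ℝ → ℝ≥0∞ := fun k y => F k y * ENNReal.ofReal (1 / y ^ 2) with hG_def
  have hk : ∀ k : ℕ, (0 : ℝ) < (k : ℝ) + 1 := fun k => Nat.cast_add_one_pos k
  -- (a) each `∫ G k ≤ π β` (the engine's core at time `k+1`, rescaled)
  have hint : ∀ k : ℕ, ∫⁻ y, G k y ≤ ENNReal.ofReal (Real.pi * β) := by
    intro k
    have hcore := amplitude_core h1 h2 n A B V E ((k : ℝ) + 1) ψ hA hB hBpos hAV hBV hE hψV hψ1
      hAψ (hk k)
    have hG : ∀ y : ℝ, G k y = ENNReal.ofReal (1 / ((k : ℝ) + 1)) *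
        ((-(ENNReal.log ‖ampl A B E ((k : ℝ) + 1) ψ (Complex.I * (y : ℂ))‖ₑ)).toENNReal *
          ENNReal.ofReal (1 / y ^ 2)) := by
      intro y; simp only [hG_def, hF_def]; ring
    calc ∫⁻ y, G k y
        = ENNReal.ofReal (1 / ((k : ℝ) + 1)) *
            ∫⁻ y : ℝ, (-(ENNReal.log ‖ampl A B E ((k : ℝ) + 1) ψ (Complex.I * (y : ℂ))‖ₑ)).toENNReal *
              ENNReal.ofReal (1 / y ^ 2) := by
          rw [← lintegral_const_mul' _ _ ENNReal.ofReal_ne_top]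
          exact lintegral_congr fun y => hG y
      _ ≤ ENNReal.ofReal (1 / ((k : ℝ) + 1)) *
            ENNReal.ofReal (Real.pi * (((k : ℝ) + 1) * β)) := mul_le_mul' le_rfl hcore
      _ = ENNReal.ofReal (Real.pi * β) := by
          rw [← ENNReal.ofReal_mul (by positivity)]
          congr 1
          field_simp
  -- (b) measurability of every `G k`
  have hmeas : ∀ k : ℕ, Measurable (G k) := by
    intro k
    refine ((measurable_log_ampl A B E ((k : ℝ) + 1) ψ).neg.ereal_toENNReal.mul
      measurable_const).mul (ENNReal.measurable_ofReal.comp ?_)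
    exact (measurable_const (a := (1 : ℝ))).div (measurable_id.pow_const 2)
  -- (c) pointwise on `S`: `d(y)/y² ≤ liminf_k G k y` (restricted-spectrum asymptotics)
  have hptw : ∀ y ∈ S, ENNReal.ofReal (d y / y ^ 2) ≤ Filter.liminf (fun k => G k y) atTop := by
    intro y hy
    have hrate : ENNReal.ofReal (d y) ≤ Filter.liminf (fun k => F k y) atTop :=
      h4 n A B E ψ y (d y) (𝒲 n A B V ψ y) (hψW y hy) (hWinv y hy) (hd y hy)
    by_cases hy0 : y = 0
    · simp [hy0]
    rcases le_or_gt (d y) 0 with hdy | hdy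
    · rw [ENNReal.ofReal_of_nonpos (div_nonpos_of_nonpos_of_nonneg hdy (sq_nonneg y))]
      exact bot_le
    calc ENNReal.ofReal (d y / y ^ 2)
        = ENNReal.ofReal (d y) * ENNReal.ofReal (1 / y ^ 2) := by
          rw [div_eq_mul_one_div, ENNReal.ofReal_mul hdy.le]
      _ ≤ Filter.liminf (fun k => F k y) atTop * ENNReal.ofReal (1 / y ^ 2) :=
          mul_le_mul' hrate le_rfl
      _ = Filter.liminf (fun k => F k y * ENNReal.ofReal (1 / y ^ 2)) atTop := by
          rw [ENNReal.liminf_mul_const_of_ne_top ENNReal.ofReal_ne_top, mul_comm]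
      _ = Filter.liminf (fun k => G k y) atTop := rfl
  -- (d) Fatou
  have hfatou : ∫⁻ y, Filter.liminf (fun k => G k y) atTop ≤
      Filter.liminf (fun k => ∫⁻ y, G k y) atTop :=
    lintegral_liminf_le hmeas
  have hlim : Filter.liminf (fun k => ∫⁻ y, G k y) atTop ≤ ENNReal.ofReal (Real.pi * β) :=
    Filter.liminf_le_of_frequently_le' (Filter.Frequently.of_forall hint)
  have hmeasL : Measurable fun y => Filter.liminf (fun k => G k y) atTop :=
    Measurable.liminf hmeas
  calc ∫⁻ y in S, ENNReal.ofReal (d y / y ^ 2)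
      ≤ ∫⁻ y, Filter.liminf (fun k => G k y) atTop :=
        setLIntegral_le_lintegral_of_forall_mem S hmeasL hptw
    _ ≤ Filter.liminf (fun k => ∫⁻ y, G k y) atTop := hfatou
    _ ≤ ENNReal.ofReal (Real.pi * β) := hlim

/-- The engine modulo its two stubs. -/
theorem kkAmplitudeFloor : KkAmplitudeFloor := kkAmplitudeFloor_of stub_contractivity stub_jensen

/-- **The rung modulo the three stubs** (this is what `ledger skeleton check` audits). -/
theorem kkSubspaceFloor : KkSubspaceFloor :=
  KkSubspaceFloor_of stub_contractivity stub_jensen stub_liminf_rate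

/-- Sanity (floor = top member): the rung gives back the proved floor's statement. -/
theorem kkFloorTheorem_of_rung (h : KkSubspaceFloor) :
    Summit.HubbardSuperconductivity.HubbardSuperconductivity.Theses.KkFloor.KkFloorTheorem := by
  intro n _ _ A B V E S d ψ hA hB hBpos hAV hBV hE hψV hψ1 hAψ hd
  refine h sectorSel n A B V E S d ψ hA hB hBpos hAV hBV hE hψV hψ1 hAψ (fun _ _ => hψV) ?_ hd
  intro y _ v hv
  simp only [sectorSel] at hv ⊢
  rw [add_mulVec, smul_mulVec]
  exact V.add_mem (hAV v hv) (V.smul_mem _ (hBV v hv))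

end Summit.HubbardSuperconductivity.HubbardSuperconductivity.Cruxes.KkBandLift.SubspaceFloor
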